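import Summits.ABC.StewartYu.PadicG3TwoSlabClass
import Summits.ABC.StewartYu.PadicG3TwoSiegel
import HarnessLib

/-!
# Cell abc-stewartyu, Gen-3 frame at `p = 2` (crux `Y07Two`, stmt-ABC-19659), layer F3-SLAB: LEVEL 0 ON THE
# SLAB — pigeonhole class, then Siegel's lemma on that class

`Summits/ABC/StewartYu/PadicG3TwoSlabSiegel.lean` — cell `abc-stewartyu` (HOME `run/shared/lean/pub/abc-stewartyu/`),
route `PadicPrimesKummerThird`, seat p3 (g5), F-two LEAD (design of record D-F2).  One theorem on `TwoSetup`,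
composing `PadicG3TwoSlabClass.exists_slabTwo` (a class `𝔏 ⊆ B`, `#B ≤ 2^m·#𝔏`, on which
`‖δexpo i₀ i‖ ≤ 2^{−(m+3)}` for every base point `i₀ ∈ 𝔏`) with `PadicG3TwoSiegel.exists_g3_siegel` on
`B := 𝔏` (count `2·2^m·#E ≤ #B` ⇒ `2·#E ≤ #𝔏`, `SiegelFinset.two_mul_card_le_of_class`): LEVEL 0 of the frame
in the design of record — integer coefficients `p ≠ 0` supported on ONE slab class, `|pᵢ| ≤ ⌈#𝔏·Amax⌉`,
`φ_τ(x) = 0` on `E`, and the slab hypothesis that `PadicG3TwoSlabKStep` needs for the extrapolation with gain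
`(4·2^m)` per zero.

WHAT THIS IS NOT: no choice of `m`, box, `E` (record); no crux moves.

References: K. Yu, Acta Arith. 89 (1999), p. 340; K. Yu, Acta Math. 211 (2013), Lemma 4.2, (4.19).
-/

noncomputable section

open Finset Polynomial
open Literature.NumberTheory.Transcendental
open Literature.NumberTheory.Transcendental.CW77.Setup (Tau tauNorm)

namespace Summit.ABC.StewartYu

namespace TwoSetup

variable (S : TwoSetup) {ι : Type*} (R : ι → ℚ[X]) (u : ι → Fin S.d → ℤ) (uθ : ι → ℤ)

/-- **LEVEL 0 ON THE SLAB.**  For a finite unknown set `B` (signed box, `|𝔛ⱼ| ≤ Xb`), a depth `m` with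
`‖Λ₀‖ ≤ 2^{−(m+3)}` (the negated bound), equations `E` (nonempty) with `2·2^m·#E ≤ #B`, and the `Y₀`-weight /
size data of `exists_g3_siegel`: there are a slab class `𝔏 ⊆ B` (`#B ≤ 2^m·#𝔏`, nonempty, slab hypothesis for
every base point in `𝔏`) and integer coefficients `p` supported in `𝔏`, not all zero, `|pᵢ| ≤ ⌈#𝔏·Amax⌉`,
with `g3φ (B := 𝔏) τ x = 0` for all `(x, τ) ∈ E`. [cite: Yu1999, p. 340] [cite: Yu2013, Lemma 4.2] -/
theorem exists_g3_slab_siegel [DecidableEq ι] (B : Finset ι) (m : ℕ)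
    (hΛ : ‖S.Λ₀‖ ≤ ((2 : ℝ) ^ (m + 3))⁻¹)
    (E : Finset (ℤ × Tau S.d)) (hE : E.Nonempty) (hcard : 2 * 2 ^ m * E.card ≤ B.card)
    {Dbox : Fin S.d → ℕ} {Dθ : ℕ} (hu : ∀ i ∈ B, ∀ j, |u i j| ≤ (Dbox j : ℤ))
    (huθ : ∀ i ∈ B, |uθ i| ≤ (Dθ : ℤ))
    (den₀ : ℤ × Tau S.d → ℕ) (hden₀ : ∀ e ∈ E, 1 ≤ den₀ e) {M₀ : ℤ}
    (hR : ∀ e ∈ E, ∀ i ∈ B,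
      ∃ z₀ : ℤ, (den₀ e : ℚ) * (hasseDeriv e.2.1 (R i)).eval (e.1 : ℚ) = z₀ ∧ |z₀| ≤ M₀)
    {Xb : ℤ} (hX : ∀ i ∈ B, ∀ j, |S.dirScalar (u i) (uθ i) j| ≤ Xb)
    {Amax : ℝ} (hAmax : 1 ≤ Amax)
    (hA : ∀ e ∈ E, (M₀ : ℝ) * (Xb : ℝ) ^ (∑ j, e.2.2 j) *
      ((MonomialDen.monDen S.toQ.all (S.boxExp Dbox Dθ e.1) : ℝ)) ^ 2 ≤ Amax) :
    ∃ (𝔏 : Finset ι) (p : ι → ℤ), 𝔏 ⊆ B ∧ B.card ≤ 2 ^ m * 𝔏.card ∧ 𝔏.Nonempty ∧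
      (∀ i₀ ∈ 𝔏, ∀ i ∈ 𝔏, ‖S.δexpo u uθ i₀ i‖ ≤ ((2 : ℝ) ^ (m + 3))⁻¹) ∧
      (∀ i, p i ≠ 0 → i ∈ 𝔏) ∧ (∃ i, p i ≠ 0) ∧
      (∀ i, |p i| ≤ ⌈(𝔏.card : ℝ) * Amax⌉) ∧
      ∀ e ∈ E, S.g3φ R u uθ 𝔏 p e.2 e.1 = 0 := by
  obtain ⟨𝔏, hsub, hcnt, hslab⟩ := S.exists_slabTwo u uθ m B hΛ
  have h2m : 0 < 2 ^ m := pow_pos two_pos m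
  have hcard' : 2 * E.card ≤ 𝔏.card :=
    SiegelFinset.two_mul_card_le_of_class h2m hcnt (by simpa [mul_comm, mul_assoc, mul_left_comm] using hcard)
  have h𝔏ne : 𝔏.Nonempty := by
    rw [← Finset.card_pos]
    have := Finset.card_pos.mpr hE
    omega
  obtain ⟨p, hsupp, hne, hbound, hsol⟩ :=
    S.exists_g3_siegel R u uθ 𝔏 E hE hcard' (fun i hi => hu i (hsub hi)) (fun i hi => huθ i (hsub hi))
      den₀ hden₀ (fun e he i hi => hR e he i (hsub hi)) (fun i hi => hX i (hsub hi)) hAmax hA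
  exact ⟨𝔏, p, hsub, hcnt, h𝔏ne, hslab, hsupp, hne, hbound, hsol⟩

end TwoSetup

end Summit.ABC.StewartYu

end
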